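import Mathlib
import Literature.Geometry.Lorentzian.ReggeWheelerTortoise

/-!
# Crux `UniformPhotonSphereChannels` (K1), negative side — the spin-1 Regge–Wheeler potential in
# the near-horizon frame: size and slow variation

Support file of the standing disprover of item stmt-FinalStateConjecture-10045.  For a tortoise
radius function `r` (`IsTortoiseRadius M r 0`, photon sphere at the origin) and the spin-1
Regge–Wheeler potential `V(x) = ℓ(ℓ+1)(1 − 2M/r)/r²`, the potential of the conformally related
near-horizon Minkowski problem is `w(x) = e^{−x/2M} V(x)`.  The tortoise identity
`r − 2M = M e^{x/2M} e^{(3M−r)/2M}` (`sub_two_mul_eq`) gives the closed form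
`w = ℓ(ℓ+1) M e^{(3M−r)/2M}/r³` (`w_eq`), whence

* `w ≤ w_max = ℓ(ℓ+1) e^{1/2}/(8M²)` everywhere, `w ≥ ℓ(ℓ+1)/(27M²)` where `x ≤ 0`
  (`w_le`, `w_ge`): the potential seen in the horizon frame is a MASS of size `≍ ℓ/M`, bounded
  above and below on the near side of the photon sphere;
* `|w′(x)| ≤ (e^{1/2}/M) w_max e^{x/2M}` (`abs_deriv_w_le`): its variation is suppressed by the
  red-shift factor `e^{x/2M}` — this is what makes the mass slowly varying on a triangle
  `X ≲ X_e = 4M e^{−ρ/4M}` once the ball is large, the small parameter of the refutation.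
[folklore]
-/

namespace Summit.FinalStateConjecture.FinalStateConjecture.Theorems

open Set Filter Topology Real Literature.Geometry.Lorentzian.ReggeWheeler

noncomputable section

namespace RWNear

variable {M : ℝ} {r : ℝ → ℝ} {L : ℝ}

/-- **Tortoise identity at the horizon**: `r(x) − 2M = M e^{x/2M} e^{(3M − r(x))/2M}`. -/
theorem sub_two_mul_eq (h : IsTortoiseRadius M r 0) (x : ℝ) :
    r x - 2 * M = M * exp (x / (2 * M)) * exp ((3 * M - r x) / (2 * M)) := by
  have hM := h.mass_pos
  have hs := h.sub_pos x
  have key := h.tortoiseCoord_eq x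
  rw [tortoiseCoord, sub_zero] at key
  -- `x/2M = r/2M + log(r − 2M) − 3/2 − log M`
  have h1 : x / (2 * M) + (3 * M - r x) / (2 * M) = Real.log (r x - 2 * M) - Real.log M := by
    rw [← add_div, div_eq_iff (by positivity)]
    linarith [key]
  rw [mul_assoc, ← Real.exp_add, h1, Real.exp_sub, Real.exp_log hs, Real.exp_log hM]
  field_simp

/-- `1 − 2M/r = (M/r) e^{x/2M} e^{(3M−r)/2M}`. -/
theorem one_sub_div_eq (h : IsTortoiseRadius M r 0) (x : ℝ) :
    1 - 2 * M / r x = M / r x * exp (x / (2 * M)) * exp ((3 * M - r x) / (2 * M)) := by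
  have hr := h.pos x
  have heq : 1 - 2 * M / r x = (r x - 2 * M) / r x := by field_simp
  rw [heq, sub_two_mul_eq h x]
  field_simp

/-- Closed form of the near-horizon mass: `e^{−x/2M} V(x) = ℓ(ℓ+1) M e^{(3M−r)/2M}/r³` for
`V = ℓ(ℓ+1)(1 − 2M/r)/r²`. -/
theorem w_eq (h : IsTortoiseRadius M r 0) (L x : ℝ) :
    (1 - 2 * M / r x) * (L / r x ^ 2) * exp (-(x / (2 * M)))
      = L * M * exp ((3 * M - r x) / (2 * M)) / r x ^ 3 := by
  have hr := h.pos x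
  rw [one_sub_div_eq h x, Real.exp_neg]
  have hE : exp (x / (2 * M)) ≠ 0 := (exp_pos _).ne'
  field_simp

/-- Upper bound: `e^{−x/2M} V(x) ≤ ℓ(ℓ+1) e^{1/2}/(8M²)` (any `x`; `L = ℓ(ℓ+1) ≥ 0`). -/
theorem w_le (h : IsTortoiseRadius M r 0) (hL : 0 ≤ L) (x : ℝ) :
    (1 - 2 * M / r x) * (L / r x ^ 2) * exp (-(x / (2 * M))) ≤ L * exp (1 / 2) / (8 * M ^ 2) := by
  have hM := h.mass_pos
  have hr := h.pos x
  have h2 := h.two_mul_lt x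
  rw [w_eq h L x]
  have hexp : exp ((3 * M - r x) / (2 * M)) ≤ exp (1 / 2) := by
    apply exp_le_exp.mpr
    rw [div_le_iff₀ (by positivity)]; linarith
  have hcube : (2 * M) ^ 3 ≤ r x ^ 3 := by
    exact pow_le_pow_left₀ (by positivity) h2.le 3
  calc L * M * exp ((3 * M - r x) / (2 * M)) / r x ^ 3
      ≤ L * M * exp (1 / 2) / (2 * M) ^ 3 := by
        apply div_le_div₀ (by positivity) (by gcongr) (by positivity) hcube
    _ = L * exp (1 / 2) / (8 * M ^ 2) := by field_simp; ring

/-- Lower bound on the near side of the photon sphere: for `x ≤ 0` (i.e. `r ≤ 3M`),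
`e^{−x/2M} V(x) ≥ ℓ(ℓ+1)/(27M²)`. -/
theorem w_ge (h : IsTortoiseRadius M r 0) (hL : 0 ≤ L) {x : ℝ} (hx : x ≤ 0) :
    L / (27 * M ^ 2) ≤ (1 - 2 * M / r x) * (L / r x ^ 2) * exp (-(x / (2 * M))) := by
  have hM := h.mass_pos
  have hr := h.pos x
  have h3 : r x ≤ 3 * M := by
    rw [← h.center]; exact h.strictMono.monotone hx
  rw [w_eq h L x]
  have hexp : 1 ≤ exp ((3 * M - r x) / (2 * M)) := by
    apply one_le_exp
    exact div_nonneg (by linarith) (by positivity)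
  have hcube : r x ^ 3 ≤ (3 * M) ^ 3 := pow_le_pow_left₀ hr.le h3 3
  calc L / (27 * M ^ 2) = L * M * 1 / (3 * M) ^ 3 := by field_simp; ring
    _ ≤ L * M * exp ((3 * M - r x) / (2 * M)) / r x ^ 3 := by
        apply div_le_div₀ (by positivity) (by gcongr) (by positivity) hcube

/-- The derivative of `x ↦ e^{−x/2M} V(x)` along the tortoise line. -/
theorem hasDerivAt_w (h : IsTortoiseRadius M r 0) (L x : ℝ) :
    HasDerivAt (fun x => (1 - 2 * M / r x) * (L / r x ^ 2) * exp (-(x / (2 * M))))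
      (-(L * M * exp ((3 * M - r x) / (2 * M)) / r x ^ 3)
        * (1 - 2 * M / r x) * (1 / (2 * M) + 3 / r x)) x := by
  have hM := h.mass_pos
  have hr := h.pos x
  -- work with the closed form
  have hfun : (fun x => (1 - 2 * M / r x) * (L / r x ^ 2) * exp (-(x / (2 * M))))
      = fun x => L * M * exp ((3 * M - r x) / (2 * M)) / r x ^ 3 := funext (w_eq h L)
  rw [hfun]
  have hr' := h.hasDerivAt x
  have hE : HasDerivAt (fun x => exp ((3 * M - r x) / (2 * M)))
      (exp ((3 * M - r x) / (2 * M)) * (-(1 - 2 * M / r x) / (2 * M))) x := by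
    have h1 : HasDerivAt (fun x => (3 * M - r x) / (2 * M)) (-(1 - 2 * M / r x) / (2 * M)) x := by
      simpa using (hr'.const_sub (3 * M)).div_const (2 * M)
    exact h1.exp
  have hnum : HasDerivAt (fun x => L * M * exp ((3 * M - r x) / (2 * M)))
      (L * M * (exp ((3 * M - r x) / (2 * M)) * (-(1 - 2 * M / r x) / (2 * M)))) x :=
    hE.const_mul (L * M)
  have hden : HasDerivAt (fun x => r x ^ 3) (3 * r x ^ 2 * (1 - 2 * M / r x)) x := by
    simpa using hr'.fun_pow 3
  have hq := hnum.div hden (by positivity : r x ^ 3 ≠ 0)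
  refine hq.congr_deriv ?_
  field_simp
  ring

/-- **Slow variation**: `|(e^{−x/2M}V)′(x)| ≤ (e^{1/2}/M) · w_max · e^{x/2M}`,
`w_max = ℓ(ℓ+1) e^{1/2}/(8M²)`. -/
theorem abs_deriv_w_le (h : IsTortoiseRadius M r 0) (hL : 0 ≤ L) (x : ℝ) :
    |deriv (fun x => (1 - 2 * M / r x) * (L / r x ^ 2) * exp (-(x / (2 * M)))) x|
      ≤ exp (1 / 2) / M * (L * exp (1 / 2) / (8 * M ^ 2)) * exp (x / (2 * M)) := by
  have hM := h.mass_pos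
  have hr := h.pos x
  have h2 := h.two_mul_lt x
  rw [(hasDerivAt_w h L x).deriv]
  -- `w ≤ w_max`, `0 ≤ 1 − 2M/r ≤ (e^{1/2}/2) e^{x/2M}`, `1/2M + 3/r ≤ 2/M`
  have hw : L * M * exp ((3 * M - r x) / (2 * M)) / r x ^ 3 ≤ L * exp (1 / 2) / (8 * M ^ 2) := by
    rw [← w_eq h L x]; exact w_le h hL x
  have hw0 : 0 ≤ L * M * exp ((3 * M - r x) / (2 * M)) / r x ^ 3 := by positivity
  have hred0 : 0 ≤ 1 - 2 * M / r x := (h.deriv_pos x).le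
  have hred : 1 - 2 * M / r x ≤ exp (1 / 2) / 2 * exp (x / (2 * M)) := by
    rw [one_sub_div_eq h x]
    have h1 : M / r x ≤ 1 / 2 := by rw [div_le_iff₀ hr]; linarith
    have h2' : exp ((3 * M - r x) / (2 * M)) ≤ exp (1 / 2) := by
      apply exp_le_exp.mpr; rw [div_le_iff₀ (by positivity)]; linarith
    calc M / r x * exp (x / (2 * M)) * exp ((3 * M - r x) / (2 * M))
        ≤ 1 / 2 * exp (x / (2 * M)) * exp (1 / 2) := by gcongr
      _ = exp (1 / 2) / 2 * exp (x / (2 * M)) := by ring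
  have hfac : 1 / (2 * M) + 3 / r x ≤ 2 / M := by
    have : 3 / r x ≤ 3 / (2 * M) := div_le_div_of_nonneg_left (by norm_num) (by positivity) h2.le
    have e : 1 / (2 * M) + 3 / (2 * M) = 2 / M := by field_simp; norm_num
    linarith
  have hfac0 : 0 ≤ 1 / (2 * M) + 3 / r x := by positivity
  rw [abs_mul, abs_mul, abs_neg, abs_of_nonneg hw0, abs_of_nonneg hred0, abs_of_nonneg hfac0]
  calc L * M * exp ((3 * M - r x) / (2 * M)) / r x ^ 3 * (1 - 2 * M / r x) * (1 / (2 * M) + 3 / r x)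
      ≤ (L * exp (1 / 2) / (8 * M ^ 2)) * (exp (1 / 2) / 2 * exp (x / (2 * M))) * (2 / M) := by
        gcongr
    _ = exp (1 / 2) / M * (L * exp (1 / 2) / (8 * M ^ 2)) * exp (x / (2 * M)) := by ring

end RWNear

end

end Summit.FinalStateConjecture.FinalStateConjecture.Theorems
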